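import Mathlib
import HarnessLib
import Summits.Ventures.LatticeQCDFlow.Exactness.IMHKernel
import Summits.Ventures.LatticeQCDFlow.Exactness.FlowSamplerFluxSymmetricAcceptance

/-!
# LatticeQCDFlow / Exactness — DELAYED REJECTION ON FLOW PROPOSALS IS EXACT ON A GENERAL STATE SPACE:
# after a rejected flow draw, a SECOND independent flow draw accepted with the Tierney–Mira ratio keeps `π = w·q` invariant

HONEST FRAMING: exact (Metropolis-corrected) sampling algorithms for lattice gauge theory;
figures of merit are autocorrelation/cost numbers at stated couplings and volumes; no
continuum-physics claim.

Venture `LatticeQCDFlow` (cell pub-lqcd), topic `Exactness`, FANOUT row 30 (lean-1 GEN-43, theme SECOND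
CHANCES — delayed rejection, retries and early stopping for flow proposals).  NEW WORK of the cell over
`IMHKernel` (`imhAccept`, `imhAcceptE`, `imhAcceptMass`, `indepMH`) and `FlowSamplerFluxSymmetricAcceptance`
(`fluxSymmetric_isReversible`); no definition is introduced, nothing is cited as a fact.  Printed
counterparts, NAMED ONLY: Tierney–Mira, "Some adaptive Monte Carlo methods for Bayesian inference",
Statist. Med. 18 (1999) 2507, §4 (the delayed-rejection rule and its detailed balance); Mira, Metron 59
(2001) (the `n`-stage rule); Green–Mira, Biometrika 88 (2001) 1035.  The tree has the FINITE-state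
Tierney–Mira rule with an arbitrary second stage (`Literature.Probability.MarkovChains.DelayedRejection`,
`Scoring.FlowProposalComposites`: "NOT CLAIMED: general state spaces") — here: general measurable `Ω`,
both stages drawn from the flow.

## Setting (general measurable `Ω`; flow law `q`, a probability measure; weight `w > 0` measurable; `π = w·q`)

One update of the DELAYED-REJECTION FLOW SAMPLER from `x`:
1. draw `y₁ ∼ q`; accept it with the Metropolis probability `a(x, y₁) = min(1, w(y₁)/w(x))`;
2. if `y₁` was rejected, draw a FRESH `y₂ ∼ q` and accept it with the Tierney–Mira probability
   `a₂(x, y₁, y₂) = min(1, w(y₂)·(1 − a(y₂, y₁)) / (w(x)·(1 − a(x, y₁))))` — the ratio of the weights of the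
   reversed path `y₂ → y₁ (rejected) → x` and the forward path (for INDEPENDENT proposals the flow
   densities `q(y₁)`, `q(y₂)` cancel);
3. otherwise stay at `x`.
Def-free bookkeeping: the second stage enters only through the product
`d(x, y₁, y₂) = (1 − a(x, y₁))·a₂(x, y₁, y₂) = min(1 − a(x, y₁), w(y₂)(1 − a(y₂, y₁))/w(x))` (no division by a
vanishing rejection probability; `drSecond_eq_mul` recovers the two factors whenever the first stage can
reject), and the kernel is ANY Markov kernel `K` with
`K(x, B) = ∫_B a(x, y) q(dy) + ∫ (∫_B d(x, y₁, y₂) q(dy₂)) q(dy₁) + (1 − m(x))·1_B(x)`,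
`m(x) = ∫ a(x, ·) dq + ∫∫ d(x, y₁, y₂) q(dy₂) q(dy₁)` (hypothesis `hK`).

## Results [all ours]

* `mul_drSecond` ∕ `drSecond_flux_symm`: `w(x)·d(x, y₁, y₂) = min(w(x)(1 − a(x, y₁)), w(y₂)(1 − a(y₂, y₁)))` — symmetric
  under `x ↔ y₂` for every intermediate `y₁`: THE SECOND-STAGE FLUX IS SYMMETRIC.
* `drSecond_le_one_sub`: `d(x, y₁, y₂) ≤ 1 − a(x, y₁)` (the second stage is reached only through a rejection), hence
  `drMass_le_one`: `m(x) ≤ 1` — the three branches are the law of one update.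
* `drDensity_flux_symm`: the TOTAL landing density `ã(x, y) = a(x, y) + ∫ d(x, y₁, y) q(dy₁)` is flux-symmetric,
  `w(x)·ã(x, y) = w(y)·ã(y, x)` (Tonelli is not even needed: pointwise symmetry under the `y₁`-integral).
* `dr_apply_eq_density`: the two-stage set formula IS an accept/reject kernel with density `ã` (Tonelli swaps
  `y₁` and `y₂`).
* **`delayedRejection_isReversible` ∕ `delayedRejection_invariant`**: EVERY such kernel is `π`-reversible and leaves
  `π = w·q` invariant — for every flow `q` and every positive measurable weight `w`: a second, correctly
  priced flow draw after a rejection never biases the sampled law.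
* `dr_apply_ge_indepMH`: off the current state the delayed-rejection kernel dominates the plain flow sampler,
  `K(x, B) ≥ indepMH q w (x, B)` for `B ∌ x` (it only ADDS accepted moves) — the input of the tree's
  `OffDiagonalDominationLagOne` (lag-one ordering) and of the Doeblin transfer, drawn in the sequel.

Not here: the rate and sticking-floor statements (sequels), the naive retry WITHOUT the Tierney–Mira price
(it is biased — sequel), `n > 2` stages, state-dependent second stages.
-/

namespace Summit.Ventures.LatticeQCDFlow.Exactness

open MeasureTheory ProbabilityTheory
open scoped ENNReal

variable {Ω : Type*} [MeasurableSpace Ω] {q : Measure Ω} [IsProbabilityMeasure q] {w : Ω → ℝ}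

/-! ## §0 The second-stage product density: algebra -/

omit [MeasurableSpace Ω] in
/-- The first-stage rejection probability `1 − a(x, y)` is non-negative. [ours, bookkeeping] -/
theorem one_sub_imhAccept_nonneg (w : Ω → ℝ) (x y : Ω) : 0 ≤ 1 - imhAccept w x y :=
  sub_nonneg.2 (imhAccept_le_one w x y)

omit [MeasurableSpace Ω] in
/-- The second-stage product density `d(x, y₁, y₂) = min(1 − a(x, y₁), w(y₂)(1 − a(y₂, y₁))/w(x))` is non-negative. [ours, bookkeeping] -/
theorem drSecond_nonneg (hw0 : ∀ x, 0 < w x) (x y₁ y₂ : Ω) :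
    0 ≤ min (1 - imhAccept w x y₁) (w y₂ * (1 - imhAccept w y₂ y₁) / w x) :=
  le_min (one_sub_imhAccept_nonneg w x y₁)
    (div_nonneg (mul_nonneg (hw0 y₂).le (one_sub_imhAccept_nonneg w y₂ y₁)) (hw0 x).le)

omit [MeasurableSpace Ω] in
/-- `d(x, y₁, y₂) ≤ 1 − a(x, y₁)`: the second stage is entered only through a first-stage rejection. [ours] -/
theorem drSecond_le_one_sub_real (w : Ω → ℝ) (x y₁ y₂ : Ω) :
    min (1 - imhAccept w x y₁) (w y₂ * (1 - imhAccept w y₂ y₁) / w x) ≤ 1 - imhAccept w x y₁ :=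
  min_le_left _ _

omit [MeasurableSpace Ω] in
/-- **THE SECOND-STAGE FLUX**: `w(x)·d(x, y₁, y₂) = min(w(x)(1 − a(x, y₁)), w(y₂)(1 − a(y₂, y₁)))`. [ours] -/
theorem mul_drSecond (hw0 : ∀ x, 0 < w x) (x y₁ y₂ : Ω) :
    w x * min (1 - imhAccept w x y₁) (w y₂ * (1 - imhAccept w y₂ y₁) / w x) =
      min (w x * (1 - imhAccept w x y₁)) (w y₂ * (1 - imhAccept w y₂ y₁)) := by
  rw [mul_min_of_nonneg _ _ (hw0 x).le, mul_div_assoc', mul_div_cancel_left₀ _ (hw0 x).ne']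

omit [MeasurableSpace Ω] in
/-- **… IS SYMMETRIC UNDER `x ↔ y₂`** (the intermediate rejected draw `y₁` held fixed):
`w(x)·d(x, y₁, y₂) = w(y₂)·d(y₂, y₁, x)`. [ours] -/
theorem mul_drSecond_symm (hw0 : ∀ x, 0 < w x) (x y₁ y₂ : Ω) :
    w x * min (1 - imhAccept w x y₁) (w y₂ * (1 - imhAccept w y₂ y₁) / w x) =
      w y₂ * min (1 - imhAccept w y₂ y₁) (w x * (1 - imhAccept w x y₁) / w y₂) := by
  rw [mul_drSecond hw0, mul_drSecond hw0, min_comm]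

omit [MeasurableSpace Ω] in
/-- **THE ALGORITHMIC READING**: whenever the first stage can reject (`a(x, y₁) < 1`), the product density factors as
(rejection probability) × (Tierney–Mira second-stage acceptance probability):
`d(x, y₁, y₂) = (1 − a(x, y₁)) · min(1, w(y₂)(1 − a(y₂, y₁)) / (w(x)(1 − a(x, y₁))))`. [ours] -/
theorem drSecond_eq_mul {x y₁ : Ω} (y₂ : Ω) (h : imhAccept w x y₁ < 1) :
    min (1 - imhAccept w x y₁) (w y₂ * (1 - imhAccept w y₂ y₁) / w x) =
      (1 - imhAccept w x y₁) * min 1 (w y₂ * (1 - imhAccept w y₂ y₁) / (w x * (1 - imhAccept w x y₁))) := by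
  have hr : 0 < 1 - imhAccept w x y₁ := sub_pos.2 h
  rw [mul_min_of_nonneg _ _ hr.le, mul_one]
  congr 1
  rw [mul_div_assoc', mul_comm (w x) (1 - imhAccept w x y₁), mul_div_mul_left _ _ hr.ne']

omit [MeasurableSpace Ω] in
/-- The Tierney–Mira second-stage acceptance probability lies in `[0, 1]`. [ours, bookkeeping] -/
theorem drAccept₂_mem_Icc (hw0 : ∀ x, 0 < w x) (x y₁ y₂ : Ω) :
    min 1 (w y₂ * (1 - imhAccept w y₂ y₁) / (w x * (1 - imhAccept w x y₁))) ∈ Set.Icc (0 : ℝ) 1 :=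
  ⟨le_min zero_le_one (div_nonneg (mul_nonneg (hw0 y₂).le (one_sub_imhAccept_nonneg w y₂ y₁))
    (mul_nonneg (hw0 x).le (one_sub_imhAccept_nonneg w x y₁))), min_le_left _ _⟩

/-! ## §1 The `ℝ≥0∞` densities: measurability, flux symmetry, the ceiling `1 − a` -/

omit [MeasurableSpace Ω] in
/-- Flux symmetry of the second stage in `ℝ≥0∞`. [ours] -/
theorem drSecond_flux_symm (hw0 : ∀ x, 0 < w x) (x y₁ y₂ : Ω) :
    ENNReal.ofReal (w x) * ENNReal.ofReal (min (1 - imhAccept w x y₁) (w y₂ * (1 - imhAccept w y₂ y₁) / w x)) =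
      ENNReal.ofReal (w y₂) * ENNReal.ofReal (min (1 - imhAccept w y₂ y₁) (w x * (1 - imhAccept w x y₁) / w y₂)) := by
  rw [← ENNReal.ofReal_mul (hw0 x).le, ← ENNReal.ofReal_mul (hw0 y₂).le, mul_drSecond_symm hw0]

omit [MeasurableSpace Ω] in
/-- `d ≤ 1 − a` in `ℝ≥0∞`: `ofReal d(x, y₁, y₂) ≤ 1 − imhAcceptE w x y₁`. [ours] -/
theorem drSecond_le_one_sub (hw0 : ∀ x, 0 < w x) (x y₁ y₂ : Ω) :
    ENNReal.ofReal (min (1 - imhAccept w x y₁) (w y₂ * (1 - imhAccept w y₂ y₁) / w x)) ≤ 1 - imhAcceptE w x y₁ := by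
  rw [imhAcceptE, ← ENNReal.ofReal_one, ← ENNReal.ofReal_sub _ (imhAccept_nonneg hw0 x y₁)]
  exact ENNReal.ofReal_le_ofReal (drSecond_le_one_sub_real w x y₁ y₂)

/-- Joint measurability of the second-stage product density on `Ω × Ω × Ω` (as `(x, y₁, y₂)`). [ours, bookkeeping] -/
theorem measurable_drSecond (hw : Measurable w) :
    Measurable fun p : Ω × Ω × Ω =>
      ENNReal.ofReal (min (1 - imhAccept w p.1 p.2.1) (w p.2.2 * (1 - imhAccept w p.2.2 p.2.1) / w p.1)) := by
  unfold imhAccept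
  have h1 : Measurable fun p : Ω × Ω × Ω => w p.1 := hw.comp measurable_fst
  have h2 : Measurable fun p : Ω × Ω × Ω => w p.2.1 := hw.comp (measurable_fst.comp measurable_snd)
  have h3 : Measurable fun p : Ω × Ω × Ω => w p.2.2 := hw.comp (measurable_snd.comp measurable_snd)
  exact ((measurable_const.sub (measurable_const.min (h2.div h1))).min
    ((h3.mul (measurable_const.sub (measurable_const.min (h2.div h3)))).div h1)).ennreal_ofReal

variable (q) in
/-- Measurability of the marginal second-stage density `(x, y) ↦ ∫ d(x, y₁, y) q(dy₁)`. [ours, bookkeeping] -/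
theorem measurable_lintegral_drSecond (hw : Measurable w) :
    Measurable (Function.uncurry fun x y : Ω =>
      ∫⁻ y₁, ENNReal.ofReal (min (1 - imhAccept w x y₁) (w y * (1 - imhAccept w y y₁) / w x)) ∂q) := by
  have hf : Measurable fun r : (Ω × Ω) × Ω =>
      ENNReal.ofReal (min (1 - imhAccept w r.1.1 r.2) (w r.1.2 * (1 - imhAccept w r.1.2 r.2) / w r.1.1)) :=
    (measurable_drSecond hw).comp
      ((measurable_fst.comp measurable_fst).prodMk (measurable_snd.prodMk (measurable_snd.comp measurable_fst)))
  exact hf.lintegral_prod_right'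

variable (q) in
/-- Measurability of the total landing density `ã(x, y) = a(x, y) + ∫ d(x, y₁, y) q(dy₁)`. [ours, bookkeeping] -/
theorem measurable_drDensity (hw : Measurable w) :
    Measurable (Function.uncurry fun x y : Ω => imhAcceptE w x y +
      ∫⁻ y₁, ENNReal.ofReal (min (1 - imhAccept w x y₁) (w y * (1 - imhAccept w y y₁) / w x)) ∂q) :=
  (measurable_imhAcceptE hw).add (measurable_lintegral_drSecond q hw)

omit [IsProbabilityMeasure q] in
/-- **THE TOTAL LANDING DENSITY IS FLUX-SYMMETRIC**: `w(x)·ã(x, y) = w(y)·ã(y, x)` — the Metropolis part by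
`min(w x, w y)`, the second-stage part pointwise in the rejected draw `y₁`. [ours] -/
theorem drDensity_flux_symm (hw : Measurable w) (hw0 : ∀ x, 0 < w x) (x y : Ω) :
    ENNReal.ofReal (w x) * (imhAcceptE w x y +
        ∫⁻ y₁, ENNReal.ofReal (min (1 - imhAccept w x y₁) (w y * (1 - imhAccept w y y₁) / w x)) ∂q) =
      ENNReal.ofReal (w y) * (imhAcceptE w y x +
        ∫⁻ y₁, ENNReal.ofReal (min (1 - imhAccept w y y₁) (w x * (1 - imhAccept w x y₁) / w y)) ∂q) := by
  have hmx : Measurable fun y₁ => ENNReal.ofReal (min (1 - imhAccept w x y₁) (w y * (1 - imhAccept w y y₁) / w x)) :=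
    (measurable_drSecond hw).comp (measurable_const.prodMk (measurable_id.prodMk measurable_const))
  have hmy : Measurable fun y₁ => ENNReal.ofReal (min (1 - imhAccept w y y₁) (w x * (1 - imhAccept w x y₁) / w y)) :=
    (measurable_drSecond hw).comp (measurable_const.prodMk (measurable_id.prodMk measurable_const))
  rw [mul_add, mul_add, ofReal_mul_imhAcceptE hw0, ofReal_mul_imhAcceptE hw0, min_comm,
    ← lintegral_const_mul _ hmx, ← lintegral_const_mul _ hmy]
  congr 1
  exact lintegral_congr fun y₁ => drSecond_flux_symm hw0 x y₁ y

/-! ## §2 The two-stage set formula is an accept/reject kernel with density `ã` -/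

omit [IsProbabilityMeasure q] in
/-- Tonelli for the second stage: `∫ (∫_B d(x, y₁, y₂) q(dy₂)) q(dy₁) = ∫_B (∫ d(x, y₁, y) q(dy₁)) q(dy)`. [ours, bookkeeping] -/
theorem lintegral_setLIntegral_drSecond_swap [SFinite q] (hw : Measurable w) (x : Ω) (B : Set Ω) :
    ∫⁻ y₁, ∫⁻ y₂ in B, ENNReal.ofReal (min (1 - imhAccept w x y₁) (w y₂ * (1 - imhAccept w y₂ y₁) / w x)) ∂q ∂q =
      ∫⁻ y in B, ∫⁻ y₁, ENNReal.ofReal (min (1 - imhAccept w x y₁) (w y * (1 - imhAccept w y y₁) / w x)) ∂q ∂q := by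
  have hf : Measurable (Function.uncurry fun y₁ y₂ : Ω =>
      ENNReal.ofReal (min (1 - imhAccept w x y₁) (w y₂ * (1 - imhAccept w y₂ y₁) / w x))) :=
    (measurable_drSecond hw).comp (measurable_const.prodMk measurable_id)
  exact lintegral_lintegral_swap (hf.aemeasurable (μ := q.prod (q.restrict B)))

omit [IsProbabilityMeasure q] in
/-- Tonelli for the second-stage mass: `∫∫ d(x, y₁, y₂) q(dy₂) q(dy₁) = ∫ (∫ d(x, y₁, y) q(dy₁)) q(dy)`. [ours, bookkeeping] -/
theorem lintegral_lintegral_drSecond_swap [SFinite q] (hw : Measurable w) (x : Ω) :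
    ∫⁻ y₁, ∫⁻ y₂, ENNReal.ofReal (min (1 - imhAccept w x y₁) (w y₂ * (1 - imhAccept w y₂ y₁) / w x)) ∂q ∂q =
      ∫⁻ y, ∫⁻ y₁, ENNReal.ofReal (min (1 - imhAccept w x y₁) (w y * (1 - imhAccept w y y₁) / w x)) ∂q ∂q := by
  have hf : Measurable (Function.uncurry fun y₁ y₂ : Ω =>
      ENNReal.ofReal (min (1 - imhAccept w x y₁) (w y₂ * (1 - imhAccept w y₂ y₁) / w x))) :=
    (measurable_drSecond hw).comp (measurable_const.prodMk measurable_id)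
  exact lintegral_lintegral_swap (hf.aemeasurable (μ := q.prod q))

/-- **THE TWO-STAGE FORMULA AS A ONE-DENSITY KERNEL**: if
`K(x, B) = ∫_B a(x, y) dq + ∫ (∫_B d(x, y₁, y₂) q(dy₂)) q(dy₁) + (1 − m(x))·1_B(x)` then
`K(x, B) = ∫_B ã(x, y) q(dy) + (1 − ∫ ã(x, ·) dq)·1_B(x)` with `ã(x, y) = a(x, y) + ∫ d(x, y₁, y) q(dy₁)`. [ours] -/
theorem dr_apply_eq_density (hw : Measurable w) (K : Kernel Ω Ω)
    (hK : ∀ (x : Ω) {B : Set Ω}, MeasurableSet B → K x B =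
      ∫⁻ y in B, imhAcceptE w x y ∂q +
        ∫⁻ y₁, ∫⁻ y₂ in B, ENNReal.ofReal (min (1 - imhAccept w x y₁) (w y₂ * (1 - imhAccept w y₂ y₁) / w x)) ∂q ∂q +
        (1 - (imhAcceptMass q w x +
          ∫⁻ y₁, ∫⁻ y₂, ENNReal.ofReal (min (1 - imhAccept w x y₁) (w y₂ * (1 - imhAccept w y₂ y₁) / w x)) ∂q ∂q)) *
          B.indicator 1 x)
    (x : Ω) {B : Set Ω} (hB : MeasurableSet B) :
    K x B = ∫⁻ y in B, (imhAcceptE w x y +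
        ∫⁻ y₁, ENNReal.ofReal (min (1 - imhAccept w x y₁) (w y * (1 - imhAccept w y y₁) / w x)) ∂q) ∂q +
      (1 - ∫⁻ y, (imhAcceptE w x y +
        ∫⁻ y₁, ENNReal.ofReal (min (1 - imhAccept w x y₁) (w y * (1 - imhAccept w y y₁) / w x)) ∂q) ∂q) *
        B.indicator 1 x := by
  have ha : Measurable fun y => imhAcceptE w x y := (measurable_imhAcceptE hw).of_uncurry_left
  rw [hK x hB, lintegral_add_left ha, lintegral_add_left ha, lintegral_setLIntegral_drSecond_swap hw x B,
    lintegral_lintegral_drSecond_swap hw x]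
  simp only [imhAcceptMass]

/-! ## §3 Exactness -/

/-- **DELAYED REJECTION ON FLOW PROPOSALS IS EXACT — DETAILED BALANCE.**  For every flow law `q`, every positive
measurable weight `w` and ANY Markov kernel `K` realising the two-stage rule (first flow draw accepted with the Metropolis
probability; upon rejection a second, independent flow draw accepted with the Tierney–Mira probability; else stay), `K` is
reversible with respect to `π = w·q`. [ours] -/
theorem delayedRejection_isReversible (hw : Measurable w) (hw0 : ∀ x, 0 < w x) (K : Kernel Ω Ω)
    (hK : ∀ (x : Ω) {B : Set Ω}, MeasurableSet B → K x B =
      ∫⁻ y in B, imhAcceptE w x y ∂q +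
        ∫⁻ y₁, ∫⁻ y₂ in B, ENNReal.ofReal (min (1 - imhAccept w x y₁) (w y₂ * (1 - imhAccept w y₂ y₁) / w x)) ∂q ∂q +
        (1 - (imhAcceptMass q w x +
          ∫⁻ y₁, ∫⁻ y₂, ENNReal.ofReal (min (1 - imhAccept w x y₁) (w y₂ * (1 - imhAccept w y₂ y₁) / w x)) ∂q ∂q)) *
          B.indicator 1 x) :
    Kernel.IsReversible K (q.withDensity fun x => ENNReal.ofReal (w x)) :=
  fluxSymmetric_isReversible hw (measurable_drDensity q hw) (drDensity_flux_symm hw hw0) K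
    (fun x _ hB => dr_apply_eq_density hw K hK x hB)

/-- **DELAYED REJECTION ON FLOW PROPOSALS IS EXACT — INVARIANCE**: `π = w·q` is invariant under every such kernel; the second,
correctly priced chance after a rejection changes the autocorrelations, never the sampled law. [ours] -/
theorem delayedRejection_invariant (hw : Measurable w) (hw0 : ∀ x, 0 < w x) (K : Kernel Ω Ω) [IsMarkovKernel K]
    (hK : ∀ (x : Ω) {B : Set Ω}, MeasurableSet B → K x B =
      ∫⁻ y in B, imhAcceptE w x y ∂q +
        ∫⁻ y₁, ∫⁻ y₂ in B, ENNReal.ofReal (min (1 - imhAccept w x y₁) (w y₂ * (1 - imhAccept w y₂ y₁) / w x)) ∂q ∂q +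
        (1 - (imhAcceptMass q w x +
          ∫⁻ y₁, ∫⁻ y₂, ENNReal.ofReal (min (1 - imhAccept w x y₁) (w y₂ * (1 - imhAccept w y₂ y₁) / w x)) ∂q ∂q)) *
          B.indicator 1 x) :
    Kernel.Invariant K (q.withDensity fun x => ENNReal.ofReal (w x)) :=
  (delayedRejection_isReversible hw hw0 K hK).invariant

/-! ## §4 The update is a probability law, and it dominates the plain flow sampler off the diagonal -/

/-- **THE MOVE MASS IS AT MOST ONE**: `∫ a(x, ·) dq + ∫∫ d(x, y₁, y₂) q(dy₂) q(dy₁) ≤ ∫ a + ∫ (1 − a) = 1` — the three branches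
(accept the first draw ∕ accept the second ∕ stay) form one probability law, so Markov kernels realising `hK` exist. [ours] -/
theorem drMass_le_one (hw : Measurable w) (hw0 : ∀ x, 0 < w x) (x : Ω) :
    imhAcceptMass q w x +
        ∫⁻ y₁, ∫⁻ y₂, ENNReal.ofReal (min (1 - imhAccept w x y₁) (w y₂ * (1 - imhAccept w y₂ y₁) / w x)) ∂q ∂q ≤ 1 := by
  have ha : Measurable fun y => imhAcceptE w x y := (measurable_imhAcceptE hw).of_uncurry_left
  calc imhAcceptMass q w x +
        ∫⁻ y₁, ∫⁻ y₂, ENNReal.ofReal (min (1 - imhAccept w x y₁) (w y₂ * (1 - imhAccept w y₂ y₁) / w x)) ∂q ∂q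
      ≤ imhAcceptMass q w x + ∫⁻ y₁, ∫⁻ _y₂, (1 - imhAcceptE w x y₁) ∂q ∂q := by
        gcongr with y₁ y₂
        exact drSecond_le_one_sub hw0 x y₁ y₂
    _ = ∫⁻ y₁, imhAcceptE w x y₁ ∂q + ∫⁻ y₁, (1 - imhAcceptE w x y₁) ∂q := by
        simp only [imhAcceptMass, lintegral_const, measure_univ, mul_one]
    _ = ∫⁻ y₁, (imhAcceptE w x y₁ + (1 - imhAcceptE w x y₁)) ∂q := (lintegral_add_left ha _).symm
    _ = ∫⁻ _y₁, 1 ∂q := lintegral_congr fun y₁ => add_tsub_cancel_of_le (imhAcceptE_le_one w x y₁)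
    _ = 1 := by rw [lintegral_const, measure_univ, mul_one]

/-- **DELAYED REJECTION DOMINATES THE PLAIN FLOW SAMPLER OFF THE DIAGONAL**: for every `B ∌ x`,
`indepMH q w (x, B) ≤ K(x, B)` — the second stage only adds accepted moves (the hypothesis of the tree's
`OffDiagonalDominationLagOne` and of the Doeblin transfer). [ours] -/
theorem dr_apply_ge_indepMH (hw : Measurable w) (K : Kernel Ω Ω)
    (hK : ∀ (x : Ω) {B : Set Ω}, MeasurableSet B → K x B =
      ∫⁻ y in B, imhAcceptE w x y ∂q +
        ∫⁻ y₁, ∫⁻ y₂ in B, ENNReal.ofReal (min (1 - imhAccept w x y₁) (w y₂ * (1 - imhAccept w y₂ y₁) / w x)) ∂q ∂q +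
        (1 - (imhAcceptMass q w x +
          ∫⁻ y₁, ∫⁻ y₂, ENNReal.ofReal (min (1 - imhAccept w x y₁) (w y₂ * (1 - imhAccept w y₂ y₁) / w x)) ∂q ∂q)) *
          B.indicator 1 x)
    {x : Ω} {B : Set Ω} (hB : MeasurableSet B) (hx : x ∉ B) :
    indepMH q w x B ≤ K x B := by
  rw [indepMH_apply hw x hB, hK x hB, Set.indicator_of_notMem hx, mul_zero, mul_zero, add_zero, add_zero]
  exact le_self_add

omit [IsProbabilityMeasure q] in
/-- … and it never moves LESS in total: the plain sampler's acceptance mass is at most the delayed-rejection move mass,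
`∫ a(x, ·) dq ≤ m(x)`. [ours, bookkeeping] -/
theorem imhAcceptMass_le_drMass (x : Ω) :
    imhAcceptMass q w x ≤ imhAcceptMass q w x +
        ∫⁻ y₁, ∫⁻ y₂, ENNReal.ofReal (min (1 - imhAccept w x y₁) (w y₂ * (1 - imhAccept w y₂ y₁) / w x)) ∂q ∂q :=
  le_self_add

end Summit.Ventures.LatticeQCDFlow.Exactness
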